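import Mathlib
import Literature.Barriers.ValiantsHypothesis.GCTMatrixPoweringCor9
import Summits.ValiantsHypothesis.ValiantsHypothesis.Theorems.ValuativeGCTValuativeFlipDetDiagonalPencil
import Summits.ValiantsHypothesis.ValiantsHypothesis.Theorems.ValuativeGCTValuativeFlipBouquetDeterminant

/-!
# Bouquet test forms of `Det_m`

Wall-breaker axis D (det-orbit-closure multiplicity bounds) for crux `ValuativeGCT.ValuativeFlip`
(stmt-ValiantsHypothesis-12624).  Fix a base letter `i₀ : MatIdx m` and finitely many *petals*
`d : ι`, each a word `w d : Fin (ℓ d + 1) → MatIdx m` in letters `≠ i₀` (the monomial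
`x^{γ_d} = ∏_t x_{w d t}` of degree `ℓ d + 1`) with a coefficient `c d` in a commutative `k`-algebra
`R` of parameters.  If `1 + ∑_d ℓ d ≤ m`, the BOUQUET MATRIX (hub + one directed cycle of length
`ℓ d + 1` through the hub per petal, `x_{i₀}` on the diagonal, file `…BouquetDeterminant`) is an
`m × m` matrix of LINEAR forms whose determinant is

  `x_{i₀}^m + ∑_d c d • x_{i₀}^{m - ℓ d - 1} x^{γ_d}`      (no cross terms),

so this sparse form is a point of `End · det_m ⊆ Δ(det_m)`, realised as `A · det_m` for an explicit
`A ∈ End(k^{m×m})` (`bq_exists_dehomog_linSubst_detFormLex`, stated after dehomogenising `x_{i₀} ↦ 1`,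
which is all the coefficient extraction of `…BouquetCriterion` needs).  Compared with the products of
binomial blocks of `…LinearEntryDeterminants` (k3) and the diagonal pencil of `…DetDiagonalPencil` (k7
seat 2), which spend matrix size `|γ|` per monomial `x^γ`, the bouquet spends `|γ| - 1` per monomial
plus one shared hub: this is what pushes the no-equation range of `Det_m` past body `m`.
No definitions. [folklore matrix identity; the use as test forms for `Δ(det_m)` is new]
-/

set_option linter.dupNamespace false

namespace Summit.ValiantsHypothesis.ValiantsHypothesis.Theorems.ValuativeFlip

open MvPolynomial
open scoped BigOperators Matrix
open Literature.NumberTheory.DiophantineGeometry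
open Literature.Computability.AlgebraicComplexity

noncomputable section

/-- Cardinality of the vertex set of a bouquet with `pad` isolated vertices. [folklore] -/
theorem bq_card_vertices {ι : Type*} [Fintype ι] (ℓ : ι → ℕ) (pad : ℕ) :
    Fintype.card (((Σ d : ι, Fin (ℓ d)) ⊕ Fin pad) ⊕ Unit) = (∑ d, ℓ d) + pad + 1 := by
  simp [Fintype.card_sum, Fintype.card_sigma, Fintype.card_fin]

/-- **Bouquet test forms are `End`-points of `det_m`.**  For petal words `w d : Fin (ℓ d + 1) → MatIdx m`
avoiding the base letter `i₀` and coefficients `c d ∈ R`, with `1 + ∑_d ℓ d ≤ m`, there is a matrix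
`A ∈ End(R^{m×m})` such that `A · det_m`, dehomogenised at `x_{i₀} ↦ 1`, equals
`1 + ∑_d c d • ∏_t x_{w d t}`; i.e. `A · det_m = x_{i₀}^m + ∑_d c d • x_{i₀}^{m-ℓ d-1} x^{γ_d}` (it is a
form of degree `m`).  The matrix is the bouquet matrix of `…BouquetDeterminant` with `x_{i₀}` on the
diagonal, transported to `Fin m`. [new use of a folklore identity] -/
theorem bq_exists_dehomog_linSubst_detFormLex {k : Type*} [Field k] {R : Type*} [CommRing R]
    (φ : k →+* R) {m : ℕ} (i₀ : MatIdx m) {ι : Type*} [Fintype ι] [DecidableEq ι]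
    (ℓ : ι → ℕ) (w : (d : ι) → Fin (ℓ d + 1) → MatIdx m) (hw : ∀ d t, w d t ≠ i₀)
    (c : ι → R) (hm : 1 + ∑ d, ℓ d ≤ m) :
    ∃ A : Matrix (MatIdx m) (MatIdx m) R,
      aeval (fun l : MatIdx m => if h : l = i₀ then (1 : MvPolynomial {i : MatIdx m // i ≠ i₀} R)
          else X ⟨l, h⟩) (linSubst (MatIdx m) R A (map φ (detFormLex k m))) =
        1 + ∑ d, c d • ∏ t : Fin (ℓ d + 1), (X ⟨w d t, hw d t⟩ : MvPolynomial {i : MatIdx m // i ≠ i₀} R) := by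
  classical
  -- the vertex set and its enumeration by `Fin m`
  set pad : ℕ := m - (1 + ∑ d, ℓ d) with hpad
  have hcard : Fintype.card (((Σ d : ι, Fin (ℓ d)) ⊕ Fin pad) ⊕ Unit) = m := by
    rw [bq_card_vertices]; omega
  set e : (((Σ d : ι, Fin (ℓ d)) ⊕ Fin pad) ⊕ Unit) ≃ Fin m := Fintype.equivFinOfCardEq hcard with he
  -- the homogeneous bouquet matrix of linear forms
  set P : Type _ := MvPolynomial (MatIdx m) R with hP
  set c' : ι → R := fun d => (-1 : R) ^ (ℓ d) * c d with hc'
  set Mh : Matrix (((Σ d : ι, Fin (ℓ d)) ⊕ Fin pad) ⊕ Unit) (((Σ d : ι, Fin (ℓ d)) ⊕ Fin pad) ⊕ Unit)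
      (MvPolynomial (MatIdx m) R) := Matrix.of fun v v' =>
    match v, v' with
    | Sum.inl (Sum.inl ⟨d, i⟩), Sum.inl (Sum.inl ⟨d', i'⟩) =>
        if d = d' ∧ (i' : ℕ) = i then X i₀
        else if d = d' ∧ (i' : ℕ) = i + 1 then X (w d i.succ) else 0
    | Sum.inl (Sum.inl ⟨d, i⟩), Sum.inr () => if (i : ℕ) + 1 = ℓ d then X (w d i.succ) else 0
    | Sum.inl (Sum.inr p), Sum.inl (Sum.inr p') => if p = p' then X i₀ else 0
    | Sum.inr (), Sum.inl (Sum.inl ⟨d, i⟩) => if (i : ℕ) = 0 then c' d • X (w d 0) else 0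
    | Sum.inr (), Sum.inr () =>
        X i₀ + ∑ d ∈ Finset.univ.filter (fun d => ℓ d = 0), c' d • X (w d 0)
    | _, _ => 0 with hMh
  -- every entry is a linear form
  have hsmulX : ∀ (r : R) (l : MatIdx m), (r • (X l : MvPolynomial (MatIdx m) R)).IsHomogeneous 1 :=
    fun r l => (mem_homogeneousSubmodule 1 _).mp
      (Submodule.smul_mem _ r ((mem_homogeneousSubmodule 1 _).mpr (isHomogeneous_X R l)))
  have hlin : ∀ v v', (Mh v v').IsHomogeneous 1 := by
    intro v v'
    rcases v with (⟨d, i⟩ | p) | u <;> rcases v' with (⟨d', i'⟩ | p') | u'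
    · simp only [hMh, Matrix.of_apply]
      split_ifs
      · exact isHomogeneous_X _ _
      · exact isHomogeneous_X _ _
      · exact isHomogeneous_zero _ _ _
    · exact isHomogeneous_zero _ _ _
    · simp only [hMh, Matrix.of_apply]
      split_ifs
      · exact isHomogeneous_X _ _
      · exact isHomogeneous_zero _ _ _
    · exact isHomogeneous_zero _ _ _
    · simp only [hMh, Matrix.of_apply]
      split_ifs
      · exact isHomogeneous_X _ _
      · exact isHomogeneous_zero _ _ _
    · exact isHomogeneous_zero _ _ _
    · simp only [hMh, Matrix.of_apply]
      split_ifs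
      · exact hsmulX _ _
      · exact isHomogeneous_zero _ _ _
    · exact isHomogeneous_zero _ _ _
    · simp only [hMh, Matrix.of_apply]
      refine (isHomogeneous_X _ _).add ?_
      exact IsHomogeneous.sum _ _ _ fun d _ => hsmulX _ _
  -- the substitution matrix `A` realising `Mh` as `A · (X_(a,b))`
  set A : Matrix (MatIdx m) (MatIdx m) R := fun l j =>
    coeff (Finsupp.single l 1) (Mh (e.symm (ofLex j).1) (e.symm (ofLex j).2)) with hA
  have hentry : ∀ a b : Fin m,
      linSubst (MatIdx m) R A (X (toLex (a, b))) = Mh (e.symm a) (e.symm b) := by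
    intro a b
    rw [linSubst_X]
    exact (Literature.Barriers.ValiantsHypothesis.eq_sum_coeff_smul_X (hlin _ _)).symm
  have hdet : linSubst (MatIdx m) R A (map φ (detFormLex k m)) = Mh.det := by
    rw [map_detFormLex_eq_det_of, AlgHom.map_det]
    have hM : (linSubst (MatIdx m) R A).mapMatrix
        (Matrix.of fun a b : Fin m => (X (toLex (a, b)) : MvPolynomial (MatIdx m) R)) =
        Mh.submatrix e.symm e.symm := by
      ext a b
      rw [AlgHom.mapMatrix_apply, Matrix.map_apply, Matrix.of_apply, hentry, Matrix.submatrix_apply]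
    rw [hM, Matrix.det_submatrix_equiv_self]
  refine ⟨A, ?_⟩
  rw [hdet, AlgHom.map_det]
  -- the dehomogenised bouquet matrix: apply the bouquet determinant
  set ψ : MvPolynomial (MatIdx m) R →ₐ[R] MvPolynomial {i : MatIdx m // i ≠ i₀} R :=
    aeval (fun l : MatIdx m => if h : l = i₀ then (1 : MvPolynomial {i : MatIdx m // i ≠ i₀} R)
      else X ⟨l, h⟩) with hψ
  have hψ0 : ψ (X i₀) = 1 := by rw [hψ, aeval_X, dif_pos rfl]
  have hψw : ∀ d t, ψ (X (w d t)) = X ⟨w d t, hw d t⟩ := fun d t => by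
    rw [hψ, aeval_X, dif_neg (hw d t)]
  have key := bq_det_eq (S := MvPolynomial {i : MatIdx m // i ≠ i₀} R) ℓ pad
    (fun d => c' d • X ⟨w d 0, hw d 0⟩) (fun d i => X ⟨w d i.succ, hw d i.succ⟩) (ψ.mapMatrix Mh)
    ?_ ?_ ?_ ?_ ?_ ?_ ?_ ?_
  · rw [key]
    congr 1
    refine Finset.sum_congr rfl fun d _ => ?_
    rw [Fin.prod_univ_succ]
    simp only [smul_eq_C_mul, hc', map_mul, map_pow, map_neg, map_one]
    have hsq : ((-1 : MvPolynomial {i : MatIdx m // i ≠ i₀} R) ^ (ℓ d)) *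
        ((-1 : MvPolynomial {i : MatIdx m // i ≠ i₀} R) ^ (ℓ d)) = 1 := by
      rw [← pow_add, ← two_mul, pow_mul, neg_one_sq, one_pow]
    linear_combination (C (c d) * (X ⟨w d 0, hw d 0⟩ : MvPolynomial {i : MatIdx m // i ≠ i₀} R) *
      ∏ i : Fin (ℓ d), (X ⟨w d i.succ, hw d i.succ⟩ : MvPolynomial {i : MatIdx m // i ≠ i₀} R)) * hsq
  -- the nine entry identities
  · intro d i d' i'
    rw [AlgHom.mapMatrix_apply, Matrix.map_apply]
    simp only [hMh, Matrix.of_apply]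
    split_ifs <;> simp [hψ0, hψw]
  · intro d i p
    rw [AlgHom.mapMatrix_apply, Matrix.map_apply]
    simp [hMh]
  · intro p d i
    rw [AlgHom.mapMatrix_apply, Matrix.map_apply]
    simp [hMh]
  · intro p p'
    rw [AlgHom.mapMatrix_apply, Matrix.map_apply]
    simp only [hMh, Matrix.of_apply]
    split_ifs <;> simp [hψ0]
  · intro d i
    rw [AlgHom.mapMatrix_apply, Matrix.map_apply]
    simp only [hMh, Matrix.of_apply]
    split_ifs <;> simp [hψw]
  · intro p
    rw [AlgHom.mapMatrix_apply, Matrix.map_apply]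
    simp [hMh]
  · intro d i
    rw [AlgHom.mapMatrix_apply, Matrix.map_apply]
    simp only [hMh, Matrix.of_apply]
    split_ifs <;> simp [hψw]
  · rw [AlgHom.mapMatrix_apply, Matrix.map_apply]
    simp only [hMh, Matrix.of_apply, map_add, map_sum, map_smul, hψ0, hψw]

end

end Summit.ValiantsHypothesis.ValiantsHypothesis.Theorems.ValuativeFlip
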